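import Literature.NumberTheory.LFunctions.AriasDeReynaExpansion
import Literature.NumberTheory.LFunctions.SiegelMordellIntegralTwo
import Mathlib.Analysis.SpecialFunctions.Trigonometric.Bounds
import Mathlib.Analysis.SpecialFunctions.Gaussian.GaussianIntegral
import Mathlib.Analysis.Complex.ExponentialBounds
import Mathlib.Analysis.Calculus.Deriv.MeanValue
import HarnessLib

/-!
# The leading coefficient of Lehmer's form: `|C₀(p)| ≤ 1/2` (Arias de Reyna 2011, eq. (5.2) and Thm. 6.1)

Topic `Literature/NumberTheory/LFunctions` (namespace `Literature.NumberTheory.LFunctions.AriasDeReyna`).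
-/

noncomputable section

open Complex MeasureTheory Set Filter Real
open scoped Topology
open Literature.NumberTheory.LFunctions.SiegelIntegral Literature.NumberTheory.LFunctions.Gabcke

namespace Literature.NumberTheory.LFunctions

namespace AriasDeReyna

/-! ## Reduction to `a ∈ [0, 1)` -/

/-- The leading-term integral only depends on `a − ⌊a⌋` (up to the sign `(−1)^N` of `sin πx` on the shifted
line). [cite: AriasDeReyna2011, eq. (5.2) ("`F(p)`, `p = 1 − 2(a − N)`")] -/
theorem leadM_eq_neg_one_pow_mul (a : ℝ) : leadM a = (-1) ^ ⌊a⌋₊ * leadM (a - ⌊a⌋₊) := by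
  set N : ℕ := ⌊a⌋₊ with hN
  have hδ1 : a - N < 1 := by have := Nat.lt_floor_add_one a; rw [← hN] at this; linarith
  have hfl : ⌊a - (N : ℝ)⌋₊ = 0 := Nat.floor_eq_zero.2 hδ1
  have h1 : ((-1 : ℂ) ^ N) * ((-1 : ℂ) ^ N) = 1 := by rw [← pow_add, ← two_mul, pow_mul]; norm_num
  have hne : ((-1 : ℂ) ^ N) ≠ 0 := pow_ne_zero _ (by norm_num)
  have hker : ∀ u : ℝ, cexp (2 * π * I * (line ((N : ℝ) + 1 / 2) u - a) ^ 2) /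
      (2 * I * Complex.sin (π * line ((N : ℝ) + 1 / 2) u)) =
      (-1) ^ N * (cexp (2 * π * I * (line ((0 : ℕ) + 1 / 2) u - ((a - N : ℝ) : ℂ)) ^ 2) /
        (2 * I * Complex.sin (π * line ((0 : ℕ) + 1 / 2) u))) := by
    intro u
    have hline : line ((N : ℝ) + 1 / 2) u - (a : ℂ) = line ((0 : ℕ) + 1 / 2) u - ((a - N : ℝ) : ℂ) := by
      simp only [line]; push_cast; ring
    have hsin : Complex.sin (π * line ((N : ℝ) + 1 / 2) u) =
        (-1) ^ N * Complex.sin (π * line ((0 : ℕ) + 1 / 2) u) := by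
      rw [show (π : ℂ) * line ((N : ℝ) + 1 / 2) u = π * line ((0 : ℕ) + 1 / 2) u + N * π by
        simp only [line]; push_cast; ring]
      exact Complex.sin_antiperiodic.add_nat_mul_eq N
    rw [hline, hsin]
    set S : ℂ := Complex.sin (π * line ((0 : ℕ) + 1 / 2) u)
    set E : ℂ := cexp (2 * π * I * (line ((0 : ℕ) + 1 / 2) u - ((a - N : ℝ) : ℂ)) ^ 2)
    by_cases hS : S = 0
    · simp [hS]
    · have h2I : (2 : ℂ) * I ≠ 0 := mul_ne_zero two_ne_zero Complex.I_ne_zero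
      have hD : 2 * I * S ≠ 0 := mul_ne_zero h2I hS
      have hD1 : 2 * I * ((-1) ^ N * S) ≠ 0 := mul_ne_zero h2I (mul_ne_zero hne hS)
      rw [mul_div_assoc', div_eq_div_iff hD1 hD]
      linear_combination (-(E * (2 * I * S))) * h1
  rw [leadM, leadM, hfl, ← hN]
  simp_rw [hker]
  rw [integral_const_mul]
  push_cast
  ring

/-! ## The Gaussian majorant on the line through `N + ½` -/

/-- On the line through `N + ½`: `‖e^{2πi(x−a)²}/(2i sin πx)‖ ≤ ½ e^{−4πu(u + d)}`, `d = N + ½ − a`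
(`|sin π(N + ½ + u(1+i))|² = cos²(πu) + sinh²(πu) ≥ 1`). [folklore] -/
private lemma norm_lead_integrand_le (N : ℕ) (a u : ℝ) :
    ‖cexp (2 * π * I * (line (N + 1 / 2) u - a) ^ 2) / (2 * I * Complex.sin (π * line (N + 1 / 2) u))‖
      ≤ 1 / 2 * Real.exp (-4 * π * u * (u + (N + 1 / 2 - a))) := by
  set d : ℝ := N + 1 / 2 - a with hd
  have hnum : ‖cexp (2 * π * I * (line (N + 1 / 2) u - a) ^ 2)‖ = Real.exp (-4 * π * u * (u + d)) := by
    rw [Complex.norm_exp]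
    congr 1
    simp only [line, hd]
    simp only [sq, Complex.mul_re, Complex.mul_im, Complex.add_re, Complex.add_im, Complex.sub_re,
      Complex.sub_im, Complex.ofReal_re, Complex.ofReal_im, Complex.I_re, Complex.I_im, Complex.re_ofNat,
      Complex.im_ofNat, Complex.one_re, Complex.one_im]
    ring
  have hden : 2 ≤ ‖2 * I * Complex.sin (π * line (N + 1 / 2) u)‖ := by
    have hsq : ‖Complex.sin (π * line ((N : ℝ) + 1 / 2) u)‖ ^ 2
        = Real.sin (π * ((N : ℝ) + 1 / 2 + u)) ^ 2 + Real.sinh (π * u) ^ 2 := by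
      rw [show (π : ℂ) * line ((N : ℝ) + 1 / 2) u = ((π * ((N : ℝ) + 1 / 2 + u) : ℝ) : ℂ) + ((π * u : ℝ) : ℂ) * I by
        rw [line_eq]; push_cast; ring]
      exact sq_norm_sin_ofReal_add_mul_I _ _
    have hsin : Real.sin (π * ((N : ℝ) + 1 / 2 + u)) ^ 2 = Real.cos (π * u) ^ 2 := by
      rw [show π * ((N : ℝ) + 1 / 2 + u) = (π * u + π / 2) + (N : ℕ) * π by ring,
        Real.sin_add_nat_mul_pi, Real.sin_add_pi_div_two, mul_pow]
      have : ((-1 : ℝ) ^ N) ^ 2 = 1 := by rw [← pow_mul, mul_comm, pow_mul]; norm_num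
      rw [this, one_mul]
    have h1 : 1 ≤ ‖Complex.sin (π * line ((N : ℝ) + 1 / 2) u)‖ ^ 2 := by
      rw [hsq, hsin]
      have hs := Real.sin_sq_le_sq (x := π * u)
      have hsh : (π * u) ^ 2 ≤ Real.sinh (π * u) ^ 2 := by
        have h0 : |π * u| ≤ Real.sinh |π * u| := Real.self_le_sinh_iff.2 (abs_nonneg _)
        rw [← Real.abs_sinh] at h0
        nlinarith [abs_nonneg (π * u), sq_abs (π * u), sq_abs (Real.sinh (π * u))]
      nlinarith [Real.sin_sq_add_cos_sq (π * u)]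
    have h2 : 1 ≤ ‖Complex.sin (π * line ((N : ℝ) + 1 / 2) u)‖ := by
      nlinarith [norm_nonneg (Complex.sin (π * line ((N : ℝ) + 1 / 2) u))]
    rw [norm_mul, norm_mul, Complex.norm_I, Complex.norm_ofNat, mul_one]
    linarith
  rw [norm_div, hnum, div_le_iff₀ (by linarith)]
  have hpos := Real.exp_pos (-4 * π * u * (u + d))
  nlinarith

/-- **The Gaussian bound for the leading coefficient**: `|M(a)| ≤ (√2/4) e^{πd²}`, `d = N + ½ − a`
(triangle inequality on the line through `N + ½`). [cite: AriasDeReyna2011, eq. (5.2)] -/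
theorem norm_leadM_le_gauss (a : ℝ) :
    ‖leadM a‖ ≤ Real.sqrt 2 / 4 * Real.exp (π * ((⌊a⌋₊ : ℝ) + 1 / 2 - a) ^ 2) := by
  set N : ℕ := ⌊a⌋₊ with hN
  set d : ℝ := N + 1 / 2 - a with hd
  have h2 : ‖(1 : ℂ) + I‖ = Real.sqrt 2 := by rw [Complex.norm_eq_sqrt_sq_add_sq]; norm_num
  have hfun : (fun u : ℝ ↦ 1 / 2 * Real.exp (-4 * π * u * (u + d)))
      = fun u : ℝ ↦ (1 / 2 * Real.exp (π * d ^ 2)) * Real.exp (-(4 * π) * (u + d / 2) ^ 2) := by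
    funext u
    rw [show 1 / 2 * Real.exp (π * d ^ 2) * Real.exp (-(4 * π) * (u + d / 2) ^ 2)
        = 1 / 2 * Real.exp (π * d ^ 2 + -(4 * π) * (u + d / 2) ^ 2) by rw [Real.exp_add]; ring]
    congr 2; ring
  have hgauss : ∫ u : ℝ, 1 / 2 * Real.exp (-4 * π * u * (u + d)) = 1 / 4 * Real.exp (π * d ^ 2) := by
    rw [hfun, MeasureTheory.integral_const_mul]
    have h2 := MeasureTheory.integral_add_right_eq_self (μ := volume)
      (fun u : ℝ ↦ Real.exp (-(4 * π) * u ^ 2)) (d / 2)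
    rw [h2, integral_gaussian, show π / (4 * π) = (1 / 2) ^ 2 by field_simp; norm_num,
      Real.sqrt_sq (by norm_num)]
    ring
  have hint : Integrable fun u : ℝ ↦ 1 / 2 * Real.exp (-4 * π * u * (u + d)) := by
    rw [hfun]
    exact ((integrable_exp_neg_mul_sq (by positivity : (0:ℝ) < 4 * π)).comp_add_right (d / 2)).const_mul _
  have hbound : ‖∫ u : ℝ, cexp (2 * π * I * (line (N + 1 / 2) u - a) ^ 2)
      / (2 * I * Complex.sin (π * line (N + 1 / 2) u))‖ ≤ 1 / 4 * Real.exp (π * d ^ 2) := by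
    rw [← hgauss]
    exact norm_integral_le_of_norm_le hint (Eventually.of_forall fun u ↦ norm_lead_integrand_le N a u)
  rw [leadM, norm_mul, h2, ← hN]
  calc Real.sqrt 2 * ‖∫ u : ℝ, cexp (2 * π * I * (line (N + 1 / 2) u - a) ^ 2)
        / (2 * I * Complex.sin (π * line (N + 1 / 2) u))‖
      ≤ Real.sqrt 2 * (1 / 4 * Real.exp (π * d ^ 2)) := mul_le_mul_of_nonneg_left hbound (Real.sqrt_nonneg _)
    _ = Real.sqrt 2 / 4 * Real.exp (π * d ^ 2) := by ring

/-- `|M(a)| ≤ 1/2` when the saddle point is not too close to an integer: `|N + ½ − a| ≤ 0.32`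
(`(√2/4) e^{π·0.32²} = 0.4877…`). [cite: AriasDeReyna2011, eq. (5.2) and Thm. 6.1 (case `n = 0`)] -/
theorem norm_leadM_le_half_of_mid {a : ℝ} (h : |(⌊a⌋₊ : ℝ) + 1 / 2 - a| ≤ 0.32) : ‖leadM a‖ ≤ 1 / 2 := by
  refine (norm_leadM_le_gauss a).trans ?_
  set d : ℝ := (⌊a⌋₊ : ℝ) + 1 / 2 - a with hd
  have hx0 : 0 ≤ π * d ^ 2 := by positivity
  have hπ := Real.pi_lt_d6
  have hd2 : d ^ 2 ≤ 0.32 ^ 2 := by rw [← sq_abs]; exact pow_le_pow_left₀ (abs_nonneg _) h 2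
  have hx1 : π * d ^ 2 ≤ 0.3217 := by nlinarith
  set x := π * d ^ 2 with hx
  have hexp := Real.exp_bound (x := x) (by rw [abs_of_nonneg hx0]; linarith) (n := 4) (by norm_num)
  simp only [Finset.sum_range_succ, Finset.sum_range_zero, Nat.factorial] at hexp
  rw [abs_of_nonneg hx0] at hexp
  norm_num at hexp
  have hle := (abs_le.1 hexp).2
  have hs2 : Real.sqrt 2 ≤ 1.41422 := by
    rw [show (1.41422 : ℝ) = Real.sqrt (1.41422 ^ 2) by rw [Real.sqrt_sq (by norm_num)]]
    exact Real.sqrt_le_sqrt (by norm_num)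
  have hx4 : x ^ 4 ≤ 0.3217 ^ 4 := pow_le_pow_left₀ hx0 hx1 4
  have hx3 : x ^ 3 ≤ 0.3217 ^ 3 := pow_le_pow_left₀ hx0 hx1 3
  have hx2 : x ^ 2 ≤ 0.3217 ^ 2 := pow_le_pow_left₀ hx0 hx1 2
  have hex : Real.exp x ≤ 1.3796 := by linarith
  nlinarith [Real.sqrt_nonneg 2, Real.exp_pos x]


/-! ## Polynomial bounds for `sin` and `cos` -/

/-- `cos x ≤ 1 − x²/2 + x⁴/24` for `x ≥ 0`. [folklore] -/
private lemma cos_le_poly4 {x : ℝ} (hx : 0 ≤ x) : Real.cos x ≤ 1 - x ^ 2 / 2 + x ^ 4 / 24 := by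
  let F : ℝ → ℝ := fun x ↦ 1 - x ^ 2 / 2 + x ^ 4 / 24 - Real.cos x
  have hd : ∀ x, HasDerivAt F (-x + x ^ 3 / 6 + Real.sin x) x := by
    intro x
    have h := (((hasDerivAt_const x (1:ℝ)).sub ((hasDerivAt_pow 2 x).div_const 2)).add
      ((hasDerivAt_pow 4 x).div_const 24)).sub (Real.hasDerivAt_cos x)
    refine h.congr_deriv ?_
    push_cast; ring
  have hmono : MonotoneOn F (Ici 0) := by
    refine monotoneOn_of_deriv_nonneg (convex_Ici 0) (fun x _ ↦ (hd x).continuousAt.continuousWithinAt)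
      (fun x _ ↦ (hd x).differentiableAt.differentiableWithinAt) fun x hx ↦ ?_
    rw [interior_Ici] at hx
    rw [(hd x).deriv]
    have := Real.sin_ge_sub_cube (le_of_lt (mem_Ioi.1 hx))
    linarith
  have h := hmono (self_mem_Ici) (mem_Ici.2 hx) hx
  simp only [F, Real.cos_zero] at h
  norm_num at h
  linarith

/-- `sin x ≤ x − x³/6 + x⁵/120` for `x ≥ 0`. [folklore] -/
private lemma sin_le_poly5 {x : ℝ} (hx : 0 ≤ x) : Real.sin x ≤ x - x ^ 3 / 6 + x ^ 5 / 120 := by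
  let F : ℝ → ℝ := fun x ↦ x - x ^ 3 / 6 + x ^ 5 / 120 - Real.sin x
  have hd : ∀ x, HasDerivAt F (1 - x ^ 2 / 2 + x ^ 4 / 24 - Real.cos x) x := by
    intro x
    have h := (((hasDerivAt_id' x).sub ((hasDerivAt_pow 3 x).div_const 6)).add
      ((hasDerivAt_pow 5 x).div_const 120)).sub (Real.hasDerivAt_sin x)
    refine h.congr_deriv ?_
    push_cast; ring
  have hmono : MonotoneOn F (Ici 0) := by
    refine monotoneOn_of_deriv_nonneg (convex_Ici 0) (fun x _ ↦ (hd x).continuousAt.continuousWithinAt)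
      (fun x _ ↦ (hd x).differentiableAt.differentiableWithinAt) fun x hx ↦ ?_
    rw [interior_Ici] at hx
    rw [(hd x).deriv]
    have := cos_le_poly4 (le_of_lt (mem_Ioi.1 hx))
    linarith
  have h := hmono (self_mem_Ici) (mem_Ici.2 hx) hx
  simp only [F, Real.sin_zero] at h
  norm_num at h
  linarith

/-- `1 − x²/2 + x⁴/24 − x⁶/720 ≤ cos x` for `x ≥ 0`. [folklore] -/
private lemma poly6_le_cos {x : ℝ} (hx : 0 ≤ x) : 1 - x ^ 2 / 2 + x ^ 4 / 24 - x ^ 6 / 720 ≤ Real.cos x := by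
  let F : ℝ → ℝ := fun x ↦ Real.cos x - (1 - x ^ 2 / 2 + x ^ 4 / 24 - x ^ 6 / 720)
  have hd : ∀ x, HasDerivAt F (-Real.sin x - (-x + x ^ 3 / 6 - x ^ 5 / 120)) x := by
    intro x
    have h := (Real.hasDerivAt_cos x).sub ((((hasDerivAt_const x (1:ℝ)).sub ((hasDerivAt_pow 2 x).div_const 2)).add
      ((hasDerivAt_pow 4 x).div_const 24)).sub ((hasDerivAt_pow 6 x).div_const 720))
    refine h.congr_deriv ?_
    push_cast; ring
  have hmono : MonotoneOn F (Ici 0) := by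
    refine monotoneOn_of_deriv_nonneg (convex_Ici 0) (fun x _ ↦ (hd x).continuousAt.continuousWithinAt)
      (fun x _ ↦ (hd x).differentiableAt.differentiableWithinAt) fun x hx ↦ ?_
    rw [interior_Ici] at hx
    rw [(hd x).deriv]
    have := sin_le_poly5 (le_of_lt (mem_Ioi.1 hx))
    linarith
  have h := hmono (self_mem_Ici) (mem_Ici.2 hx) hx
  simp only [F, Real.cos_zero] at h
  norm_num at h
  linarith

/-! ## The trigonometric inequality behind `|F(p)| ≤ ½` near `p = ±1` -/

/-- Decimal lower bounds: `cos(π/8) ≥ 0.92387`, `sin(π/8) ≥ 0.38268`, `√2 ≥ 1.41421`. [folklore] -/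
private lemma trig_consts : (0.92387 : ℝ) ≤ Real.cos (π / 8) ∧ (0.38268 : ℝ) ≤ Real.sin (π / 8) ∧
    (1.41421 : ℝ) ≤ Real.sqrt 2 := by
  have hsq : ∀ {x y : ℝ}, 0 ≤ x → x ^ 2 ≤ y → x ≤ Real.sqrt y := by
    intro x y hx h
    rw [show x = Real.sqrt (x ^ 2) by rw [Real.sqrt_sq hx]]
    exact Real.sqrt_le_sqrt h
  have hs2l : (1.41421 : ℝ) ≤ Real.sqrt 2 := hsq (by norm_num) (by norm_num)
  have hs2u : Real.sqrt 2 ≤ 1.414214 := by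
    rw [show (1.414214 : ℝ) = Real.sqrt (1.414214 ^ 2) by rw [Real.sqrt_sq (by norm_num)]]
    exact Real.sqrt_le_sqrt (by norm_num)
  refine ⟨?_, ?_, hs2l⟩
  · rw [Real.cos_pi_div_eight]
    have : (1.84774 : ℝ) ≤ Real.sqrt (2 + Real.sqrt 2) := hsq (by norm_num) (by nlinarith)
    linarith
  · rw [Real.sin_pi_div_eight]
    have : (0.76536 : ℝ) ≤ Real.sqrt (2 - Real.sqrt 2) := hsq (by norm_num) (by nlinarith)
    linarith

/-- One piece of the inequality `6 sin πδ − 4 sin³ πδ ≤ 2√2 sin(2πδ(1−δ) + π/8)` on `δ ∈ [δ₁, δ₂] ⊆ [0, 0.18]`: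
both sides are monotone, so a numerical comparison of (a lower bound of) the right side at `δ₁` with (an upper
bound of) the left side at `δ₂` suffices. [cite: AriasDeReyna2011, Thm. 6.1 (case `n = 0`)] -/
private lemma core_piece {δ₁ δ₂ δ : ℝ} (hδ₁ : 0 ≤ δ₁) (h1 : δ₁ ≤ δ) (h2 : δ ≤ δ₂) (hδ₂ : δ₂ ≤ 9 / 50)
    (hnum : 6 * (3.141593 * δ₂ - (3.141592 * δ₂) ^ 3 / 6 + (3.141593 * δ₂) ^ 5 / 120)
        - 4 * (3.141593 * δ₂ - (3.141592 * δ₂) ^ 3 / 6 + (3.141593 * δ₂) ^ 5 / 120) ^ 3 ≤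
      2 * 1.41421 * (0.92387 * ((2 * 3.141592 * (δ₁ * (1 - δ₁))) - (2 * 3.141592 * (δ₁ * (1 - δ₁))) ^ 3 / 6)
        + 0.38268 * (1 - (2 * 3.141593 * (δ₁ * (1 - δ₁))) ^ 2 / 2 + (2 * 3.141593 * (δ₁ * (1 - δ₁))) ^ 4 / 24
          - (2 * 3.141593 * (δ₁ * (1 - δ₁))) ^ 6 / 720)))
    (hsub : 3.141593 * δ₂ - (3.141592 * δ₂) ^ 3 / 6 + (3.141593 * δ₂) ^ 5 / 120 ≤ 0.55) :
    6 * Real.sin (π * δ) - 4 * Real.sin (π * δ) ^ 3 ≤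
      2 * Real.sqrt 2 * Real.sin (2 * π * (δ * (1 - δ)) + π / 8) := by
  obtain ⟨hc8, hs8, hr2⟩ := trig_consts
  have hπl := Real.pi_gt_d6
  have hπu := Real.pi_lt_d6
  have hπ0 := Real.pi_pos
  have hδ0 : 0 ≤ δ := hδ₁.trans h1
  have hδ : δ ≤ 9 / 50 := h2.trans hδ₂
  have hδ₂0 : 0 ≤ δ₂ := hδ0.trans h2
  -- the left side: `s = sin πδ ≤ sin πδ₂ ≤ s_ub`
  obtain ⟨sU, hsU⟩ : ∃ sU : ℝ, sU = 3.141593 * δ₂ - (3.141592 * δ₂) ^ 3 / 6 + (3.141593 * δ₂) ^ 5 / 120 :=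
    ⟨_, rfl⟩
  rw [← hsU] at hnum hsub
  have hπδ : π * δ ≤ π * δ₂ := mul_le_mul_of_nonneg_left h2 hπ0.le
  have hπδ₂ : π * δ₂ ≤ π * (9 / 50) := mul_le_mul_of_nonneg_left hδ₂ hπ0.le
  have hπδ0 : 0 ≤ π * δ := mul_nonneg hπ0.le hδ0
  have hs0 : 0 ≤ Real.sin (π * δ) :=
    Real.sin_nonneg_of_nonneg_of_le_pi hπδ0 (by linarith only [hπδ, hπδ₂, hπ0])
  have hs1 : Real.sin (π * δ) ≤ Real.sin (π * δ₂) :=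
    Real.sin_le_sin_of_le_of_le_pi_div_two (by linarith only [hπδ0, hπ0]) (by linarith only [hπδ₂, hπ0]) hπδ
  have hlo : 3.141592 * δ₂ ≤ π * δ₂ := mul_le_mul_of_nonneg_right hπl.le hδ₂0
  have hhi : π * δ₂ ≤ 3.141593 * δ₂ := mul_le_mul_of_nonneg_right hπu.le hδ₂0
  have hlo0 : 0 ≤ 3.141592 * δ₂ := by positivity
  have hs2 : Real.sin (π * δ₂) ≤ sU := by
    have hp := sin_le_poly5 (x := π * δ₂) (hlo0.trans hlo)
    have e3 : (3.141592 * δ₂) ^ 3 ≤ (π * δ₂) ^ 3 := pow_le_pow_left₀ hlo0 hlo 3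
    have e5 : (π * δ₂) ^ 5 ≤ (3.141593 * δ₂) ^ 5 := pow_le_pow_left₀ (hlo0.trans hlo) hhi 5
    rw [hsU]; linarith only [hp, e3, e5, hhi]
  have hsle : Real.sin (π * δ) ≤ sU := hs1.trans hs2
  have hsU0 : 0 ≤ sU := hs0.trans hsle
  have hL : 6 * Real.sin (π * δ) - 4 * Real.sin (π * δ) ^ 3 ≤ 6 * sU - 4 * sU ^ 3 := by
    have e : 6 * sU - 4 * sU ^ 3 - (6 * Real.sin (π * δ) - 4 * Real.sin (π * δ) ^ 3) =
        (sU - Real.sin (π * δ)) * (6 - 4 * (sU ^ 2 + sU * Real.sin (π * δ) + Real.sin (π * δ) ^ 2)) := by ring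
    have hq1 : sU ^ 2 ≤ 0.55 ^ 2 := pow_le_pow_left₀ hsU0 hsub 2
    have hq2 : Real.sin (π * δ) ^ 2 ≤ 0.55 ^ 2 := pow_le_pow_left₀ hs0 (hsle.trans hsub) 2
    have hq3 : sU * Real.sin (π * δ) ≤ 0.55 * 0.55 := mul_le_mul hsub (hsle.trans hsub) hs0 (by norm_num)
    have hfac : 0 ≤ 6 - 4 * (sU ^ 2 + sU * Real.sin (π * δ) + Real.sin (π * δ) ^ 2) := by
      linarith only [hq1, hq2, hq3]
    have : 0 ≤ (sU - Real.sin (π * δ)) * (6 - 4 * (sU ^ 2 + sU * Real.sin (π * δ) + Real.sin (π * δ) ^ 2)) :=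
      mul_nonneg (sub_nonneg.2 hsle) hfac
    linarith only [e, this]
  -- the right side: `sin(x + π/8)` is increasing in `x = 2πδ(1−δ) ≥ x₁`
  obtain ⟨xl, hxl⟩ : ∃ xl : ℝ, xl = 2 * 3.141592 * (δ₁ * (1 - δ₁)) := ⟨_, rfl⟩
  obtain ⟨xu, hxu⟩ : ∃ xu : ℝ, xu = 2 * 3.141593 * (δ₁ * (1 - δ₁)) := ⟨_, rfl⟩
  rw [← hxl, ← hxu] at hnum
  have ht10 : 0 ≤ δ₁ * (1 - δ₁) := mul_nonneg hδ₁ (by linarith only [hδ₁, h1, hδ])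
  have ht1 : δ₁ * (1 - δ₁) ≤ δ * (1 - δ) := by
    nlinarith only [h1, hδ₁, hδ, mul_nonneg (sub_nonneg.2 h1) (by linarith only [h1, hδ₁, hδ] : (0:ℝ) ≤ 1 - δ - δ₁)]
  have htu : δ * (1 - δ) ≤ 0.1476 := by
    nlinarith only [mul_nonneg (by linarith only [hδ] : (0:ℝ) ≤ 0.18 - δ) (by linarith only [hδ] : (0:ℝ) ≤ 0.82 - δ)]
  have ht1u : δ₁ * (1 - δ₁) ≤ 0.1476 := ht1.trans htu
  have h2π : (0 : ℝ) ≤ 2 * π := by linarith only [hπ0]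
  have hxl0 : 0 ≤ xl := by rw [hxl]; positivity
  have hxlx : xl ≤ 2 * π * (δ₁ * (1 - δ₁)) := by
    rw [hxl]; exact mul_le_mul_of_nonneg_right (by linarith only [hπl]) ht10
  have hxux : 2 * π * (δ₁ * (1 - δ₁)) ≤ xu := by
    rw [hxu]; exact mul_le_mul_of_nonneg_right (by linarith only [hπu]) ht10
  have hxu1 : xu ≤ 1 := by rw [hxu]; linarith only [ht1u]
  have hx1x : 2 * π * (δ₁ * (1 - δ₁)) ≤ 2 * π * (δ * (1 - δ)) := mul_le_mul_of_nonneg_left ht1 h2π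
  have hxt : 2 * π * (δ * (1 - δ)) ≤ 2 * π * 0.1476 := mul_le_mul_of_nonneg_left htu h2π
  have hxtop : 2 * π * (δ * (1 - δ)) + π / 8 ≤ π / 2 := by linarith only [hxt, hπ0]
  have hx1pi : 2 * π * (δ₁ * (1 - δ₁)) ≤ π := by linarith only [hx1x, hxt, hπ0]
  have hx10 : 0 ≤ 2 * π * (δ₁ * (1 - δ₁)) := mul_nonneg h2π ht10
  have hmono : Real.sin (2 * π * (δ₁ * (1 - δ₁)) + π / 8) ≤ Real.sin (2 * π * (δ * (1 - δ)) + π / 8) :=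
    Real.sin_le_sin_of_le_of_le_pi_div_two (by linarith only [hx10, hπ0]) hxtop (by linarith only [hx1x])
  have hexp : Real.sin (2 * π * (δ₁ * (1 - δ₁)) + π / 8) =
      Real.sin (2 * π * (δ₁ * (1 - δ₁))) * Real.cos (π / 8) + Real.cos (2 * π * (δ₁ * (1 - δ₁))) * Real.sin (π / 8) :=
    Real.sin_add _ _
  have hsin1 : xl - xl ^ 3 / 6 ≤ Real.sin (2 * π * (δ₁ * (1 - δ₁))) :=
    (Real.sin_ge_sub_cube hxl0).trans (Real.sin_le_sin_of_le_of_le_pi_div_two (by linarith only [hxl0, hπ0])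
      (by linarith only [hx1x, hxtop, hπ0]) hxlx)
  have hcos1 : 1 - xu ^ 2 / 2 + xu ^ 4 / 24 - xu ^ 6 / 720 ≤ Real.cos (2 * π * (δ₁ * (1 - δ₁))) :=
    (poly6_le_cos (hxl0.trans (hxlx.trans hxux))).trans
      (Real.cos_le_cos_of_nonneg_of_le_pi hx10 (by linarith only [hxu1, hπl]) hxux)
  have hsinpos : 0 ≤ Real.sin (2 * π * (δ₁ * (1 - δ₁))) := Real.sin_nonneg_of_nonneg_of_le_pi hx10 hx1pi
  have hxu0 : 0 ≤ xu := hxl0.trans (hxlx.trans hxux)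
  have hcospos : 0 ≤ 1 - xu ^ 2 / 2 + xu ^ 4 / 24 - xu ^ 6 / 720 := by
    have h2 : xu ^ 2 ≤ 1 := pow_le_one₀ hxu0 hxu1
    have h6 : xu ^ 6 ≤ 1 := pow_le_one₀ hxu0 hxu1
    have h4 : 0 ≤ xu ^ 4 := pow_nonneg hxu0 4
    linarith only [h2, h6, h4]
  have hxl1 : xl ≤ 1 := hxlx.trans (hxux.trans hxu1)
  have hP1 : 0 ≤ xl - xl ^ 3 / 6 := by
    have : xl ^ 3 ≤ xl := by
      calc xl ^ 3 = xl * xl ^ 2 := by ring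
        _ ≤ xl * 1 := mul_le_mul_of_nonneg_left (pow_le_one₀ hxl0 hxl1) hxl0
        _ = xl := mul_one _
    linarith only [this, hxl0]
  have hA : 0.92387 * (xl - xl ^ 3 / 6) ≤ Real.sin (2 * π * (δ₁ * (1 - δ₁))) * Real.cos (π / 8) := by
    rw [mul_comm]
    exact mul_le_mul hsin1 hc8 (by norm_num) hsinpos
  have hB : 0.38268 * (1 - xu ^ 2 / 2 + xu ^ 4 / 24 - xu ^ 6 / 720) ≤
      Real.cos (2 * π * (δ₁ * (1 - δ₁))) * Real.sin (π / 8) := by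
    rw [mul_comm]
    exact mul_le_mul hcos1 hs8 (by norm_num) (hcospos.trans hcos1)
  have step : 0.92387 * (xl - xl ^ 3 / 6) + 0.38268 * (1 - xu ^ 2 / 2 + xu ^ 4 / 24 - xu ^ 6 / 720) ≤
      Real.sin (2 * π * (δ * (1 - δ)) + π / 8) := by rw [hexp] at hmono; linarith only [hmono, hA, hB]
  have hsum0 : 0 ≤ 0.92387 * (xl - xl ^ 3 / 6) + 0.38268 * (1 - xu ^ 2 / 2 + xu ^ 4 / 24 - xu ^ 6 / 720) := by
    positivity
  have hR : 2 * 1.41421 * (0.92387 * (xl - xl ^ 3 / 6) + 0.38268 * (1 - xu ^ 2 / 2 + xu ^ 4 / 24 - xu ^ 6 / 720))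
      ≤ 2 * Real.sqrt 2 * Real.sin (2 * π * (δ * (1 - δ)) + π / 8) := by
    have := mul_le_mul hr2 step hsum0 (Real.sqrt_nonneg 2)
    linarith only [this]
  linarith only [hL, hR, hnum]

/-- **The inequality `6 sin πδ − 4 sin³πδ ≤ 2√2 sin(2πδ(1−δ) + π/8)` for `0 ≤ δ ≤ 0.18`** (five pieces),
equivalent to `|F(p)| ≤ ½` for `|p| ≥ 0.64`. [cite: AriasDeReyna2011, Thm. 6.1 (case `n = 0`)] -/
theorem trig_core {δ : ℝ} (hδ0 : 0 ≤ δ) (hδ : δ ≤ 0.18) :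
    6 * Real.sin (π * δ) - 4 * Real.sin (π * δ) ^ 3 ≤
      2 * Real.sqrt 2 * Real.sin (2 * π * (δ * (1 - δ)) + π / 8) := by
  rcases le_or_gt δ (1 / 20) with h1 | h1
  · exact core_piece (δ₁ := 0) (δ₂ := 1 / 20) le_rfl hδ0 h1 (by norm_num) (by norm_num) (by norm_num)
  rcases le_or_gt δ (1 / 10) with h2 | h2
  · exact core_piece (δ₁ := 1 / 20) (δ₂ := 1 / 10) (by norm_num) h1.le h2 (by norm_num) (by norm_num) (by norm_num)
  rcases le_or_gt δ (7 / 50) with h3 | h3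
  · exact core_piece (δ₁ := 1 / 10) (δ₂ := 7 / 50) (by norm_num) h2.le h3 (by norm_num) (by norm_num) (by norm_num)
  rcases le_or_gt δ (4 / 25) with h4 | h4
  · exact core_piece (δ₁ := 7 / 50) (δ₂ := 4 / 25) (by norm_num) h3.le h4 (by norm_num) (by norm_num) (by norm_num)
  · exact core_piece (δ₁ := 4 / 25) (δ₂ := 9 / 50) (by norm_num) h4.le (by norm_num at hδ ⊢; linarith)
      (by norm_num) (by norm_num) (by norm_num)


/-! ## `|M(δ)| ≤ ½` near the integers, via the closed form -/

/-- **`|M(δ)| ≤ ½` for `δ ∈ (0, 0.18] ∪ [0.82, 1)`**: from the closed form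
`M(δ)·2cos 2πδ = e^{2πi(δ²−δ)} + √2 i e^{iπ/8} sin πδ` one gets
`|M(δ)·2cos 2πδ|² = 1 + 2 sin²πδ − 2√2 sin πδ · sin(2πδ(1−δ) + π/8) ≤ cos² 2πδ` by `trig_core`.
[cite: AriasDeReyna2011, Thm. 6.1 (case `n = 0`) with eq. (5.2)] -/
theorem norm_leadM_le_half_of_near_int {δ : ℝ} (hδ0 : 0 < δ) (hδ1 : δ < 1) (hδ : δ ≤ 0.18 ∨ 0.82 ≤ δ) :
    ‖leadM δ‖ ≤ 1 / 2 := by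
  have hδint : ∀ n : ℤ, (n : ℝ) ≠ δ := by
    intro n hn
    rw [← hn] at hδ0 hδ1
    have h0 : (0 : ℤ) < n := by exact_mod_cast hδ0
    have h1 : n < (1 : ℤ) := by exact_mod_cast hδ1
    omega
  have hfl : ⌊δ⌋₊ = 0 := Nat.floor_eq_zero.2 hδ1
  have h := rsLeadIntegral_mul_two_cos hδ0 hδint
  rw [← leadM_eq_of_not_int hδ0 hδint, hfl] at h
  simp only [pow_zero, one_mul, mul_zero, zero_add] at h
  -- the right-hand side in real coordinates
  set β : ℝ := 2 * π * δ ^ 2 - 2 * π * δ with hβ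
  set s : ℝ := Real.sin (π * δ) with hs
  set c₈ : ℝ := Real.cos (π / 8)
  set s₈ : ℝ := Real.sin (π / 8)
  have hE : cexp (2 * π * I * (δ : ℂ) ^ 2) * cexp (-(π * I * δ)) ^ 2 = (Real.cos β : ℂ) + (Real.sin β : ℂ) * I := by
    rw [← Complex.exp_nat_mul, ← Complex.exp_add, show 2 * π * I * (δ : ℂ) ^ 2 + (2 : ℕ) * -(π * I * δ)
      = (β : ℂ) * I by rw [hβ]; push_cast; ring, Complex.exp_mul_I, ← Complex.ofReal_cos, ← Complex.ofReal_sin]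
  have hE8 : cexp (π * I / 8) = (c₈ : ℂ) + (s₈ : ℂ) * I := by
    rw [show (π : ℂ) * I / 8 = ((π / 8 : ℝ) : ℂ) * I by push_cast; ring, Complex.exp_mul_I,
      ← Complex.ofReal_cos, ← Complex.ofReal_sin]
  have hsin : Complex.sin (π * δ) = (s : ℂ) := by
    rw [hs, Complex.ofReal_sin]; push_cast; ring_nf
  have hRHS : cexp (2 * π * I * (δ : ℂ) ^ 2) * cexp (-(π * I * δ)) ^ 2
      + Real.sqrt 2 * I * cexp (π * I / 8) * Complex.sin (π * δ)
      = ((Real.cos β - Real.sqrt 2 * s₈ * s : ℝ) : ℂ) + ((Real.sin β + Real.sqrt 2 * c₈ * s : ℝ) : ℂ) * I := by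
    rw [hE, hE8, hsin]
    refine Complex.ext ?_ ?_ <;>
      simp only [Complex.add_re, Complex.add_im, Complex.mul_re, Complex.mul_im, Complex.ofReal_re,
        Complex.ofReal_im, Complex.I_re, Complex.I_im] <;> ring
  rw [hRHS] at h
  -- the norm of the right-hand side
  have hx : β = -(2 * π * (δ * (1 - δ))) := by rw [hβ]; ring
  have hcosβ : Real.cos β = Real.cos (2 * π * (δ * (1 - δ))) := by rw [hx, Real.cos_neg]
  have hsinβ : Real.sin β = -Real.sin (2 * π * (δ * (1 - δ))) := by rw [hx, Real.sin_neg]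
  have hS : Real.sin (2 * π * (δ * (1 - δ)) + π / 8) =
      Real.sin (2 * π * (δ * (1 - δ))) * c₈ + Real.cos (2 * π * (δ * (1 - δ))) * s₈ := Real.sin_add _ _
  have hs0 : 0 ≤ s := Real.sin_nonneg_of_nonneg_of_le_pi (by positivity) (by nlinarith [Real.pi_pos])
  -- the inequality `6s − 4s³ ≤ 2√2 sin(x + π/8)` (at `δ` or at `1 − δ`)
  have hcore : 6 * s - 4 * s ^ 3 ≤ 2 * Real.sqrt 2 * Real.sin (2 * π * (δ * (1 - δ)) + π / 8) := by
    rcases hδ with hδ | hδ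
    · exact trig_core hδ0.le hδ
    · have h' := trig_core (δ := 1 - δ) (by linarith) (by norm_num at hδ ⊢; linarith)
      rw [show π * (1 - δ) = π - π * δ by ring, Real.sin_pi_sub, show (1 - δ) * (1 - (1 - δ)) = δ * (1 - δ) by ring]
        at h'
      exact h'
  have hexpand : (Real.cos β - Real.sqrt 2 * s₈ * s) ^ 2 + (Real.sin β + Real.sqrt 2 * c₈ * s) ^ 2
      = 1 + 2 * s ^ 2 - 2 * Real.sqrt 2 * s * Real.sin (2 * π * (δ * (1 - δ)) + π / 8) := by
    rw [hS, hcosβ, hsinβ]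
    have F1 := Real.sin_sq_add_cos_sq (2 * π * (δ * (1 - δ)))
    have F2 : s₈ ^ 2 + c₈ ^ 2 = 1 := Real.sin_sq_add_cos_sq (π / 8)
    have F3 : Real.sqrt 2 ^ 2 = 2 := Real.sq_sqrt (by norm_num)
    linear_combination F1 + (s ^ 2 * Real.sqrt 2 ^ 2) * F2 + s ^ 2 * F3
  have hcos2 : Real.cos (2 * π * δ) = 1 - 2 * s ^ 2 := by
    rw [show 2 * π * δ = 2 * (π * δ) by ring, Real.cos_two_mul, Real.cos_sq', hs]; ring
  have hsq : (Real.cos β - Real.sqrt 2 * s₈ * s) ^ 2 + (Real.sin β + Real.sqrt 2 * c₈ * s) ^ 2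
      ≤ Real.cos (2 * π * δ) ^ 2 := by
    rw [hexpand, hcos2]
    nlinarith [mul_le_mul_of_nonneg_left hcore hs0]
  have hnormR : ‖((Real.cos β - Real.sqrt 2 * s₈ * s : ℝ) : ℂ) + ((Real.sin β + Real.sqrt 2 * c₈ * s : ℝ) : ℂ) * I‖
      ≤ |Real.cos (2 * π * δ)| := by
    rw [Complex.norm_add_mul_I, ← Real.sqrt_sq_eq_abs]
    exact Real.sqrt_le_sqrt hsq
  -- `cos 2πδ ≠ 0`
  have hcosne : 0 < |Real.cos (2 * π * δ)| := by
    rcases hδ with hδ | hδ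
    · exact abs_pos_of_pos (Real.cos_pos_of_mem_Ioo ⟨by nlinarith [Real.pi_pos], by nlinarith [Real.pi_gt_three]⟩)
    · rw [← Real.cos_sub_two_pi]
      refine abs_pos_of_pos (Real.cos_pos_of_mem_Ioo ⟨by nlinarith [Real.pi_gt_three], by nlinarith [Real.pi_pos]⟩)
  -- conclude
  have hn := congrArg (fun z : ℂ ↦ ‖z‖) h
  simp only [norm_mul] at hn
  rw [show ‖Complex.cos (2 * π * δ)‖ = |Real.cos (2 * π * δ)| by
    rw [show (2 : ℂ) * π * δ = ((2 * π * δ : ℝ) : ℂ) by push_cast; ring, ← Complex.ofReal_cos,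
      Complex.norm_real, Real.norm_eq_abs], Complex.norm_ofNat] at hn
  have : ‖leadM δ‖ * (2 * |Real.cos (2 * π * δ)|) ≤ |Real.cos (2 * π * δ)| := hn ▸ hnormR
  nlinarith

/-- **Theorem (Arias de Reyna 2011, Thm. 6.1 for `C₀`): `|C₀| ≤ ½`** for every non-integer `a > 0`
(`C₀ = ±e^{−iπ/8} M(a)`; the two regimes `|N + ½ − a| ≤ 0.32` and `a` within `0.18` of an integer).
[cite: AriasDeReyna2011, Thm. 6.1 (case `n = 0`), eq. (5.2)] -/
theorem norm_coefC0_le {a : ℝ} (ha : 0 < a) (hai : ∀ n : ℤ, (n : ℝ) ≠ a) : ‖coefC0 a‖ ≤ 1 / 2 := by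
  have hnorm : ‖coefC0 a‖ = ‖leadM a‖ := by
    rw [coefC0, norm_mul, norm_mul, norm_neg, norm_pow, norm_neg, norm_one, one_pow, one_mul,
      Complex.norm_exp]
    simp
  rw [hnorm, leadM_eq_neg_one_pow_mul a, norm_mul, norm_pow, norm_neg, norm_one, one_pow, one_mul]
  set N : ℕ := ⌊a⌋₊ with hN
  have hδ0' : 0 ≤ a - N := sub_nonneg.2 (Nat.floor_le ha.le)
  have hδ0 : 0 < a - N := by
    rcases hδ0'.eq_or_lt with h | h
    · exact absurd (by have := h.symm; rw [sub_eq_zero] at this; exact_mod_cast this.symm) (hai N)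
    · exact h
  have hδ1 : a - N < 1 := by have := Nat.lt_floor_add_one a; rw [← hN] at this; linarith
  by_cases hmid : |(⌊a - (N : ℝ)⌋₊ : ℝ) + 1 / 2 - (a - N)| ≤ 0.32
  · exact norm_leadM_le_half_of_mid hmid
  · refine norm_leadM_le_half_of_near_int hδ0 hδ1 ?_
    rw [Nat.floor_eq_zero.2 hδ1, Nat.cast_zero, zero_add] at hmid
    rw [not_le] at hmid
    rcases le_or_gt (1 / 2 - (a - N)) 0 with h | h
    · rw [abs_of_nonpos h] at hmid; right; norm_num at hmid ⊢; linarith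
    · rw [abs_of_pos h] at hmid; left; norm_num at hmid ⊢; linarith


/-! ## Continuity in `a`; the integers -/

/-- `‖C₀‖ = ‖M(a)‖` (`C₀ = ±e^{−iπ/8} M(a)`). [cite: AriasDeReyna2011, eq. (5.2)] -/
theorem norm_coefC0 (a : ℝ) : ‖coefC0 a‖ = ‖leadM a‖ := by
  rw [coefC0, norm_mul, norm_mul, norm_neg, norm_pow, norm_neg, norm_one, one_pow, one_mul,
    Complex.norm_exp]
  simp

/-- `|M(a)| ≤ ½` for every non-integer `a > 0`. [cite: AriasDeReyna2011, Thm. 6.1 (case `n = 0`), eq. (5.2)] -/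
theorem norm_leadM_le_half {a : ℝ} (ha : 0 < a) (hai : ∀ n : ℤ, (n : ℝ) ≠ a) : ‖leadM a‖ ≤ 1 / 2 := by
  rw [← norm_coefC0]; exact norm_coefC0_le ha hai

/-- The denominator on the line through `N + ½` never vanishes: `‖2i sin π(N + ½ + u(1+i))‖ ≥ 2`. [folklore] -/
private lemma two_le_norm_den (N : ℕ) (u : ℝ) : 2 ≤ ‖2 * I * Complex.sin (π * line ((N : ℝ) + 1 / 2) u)‖ := by
  have hsq : ‖Complex.sin (π * line ((N : ℝ) + 1 / 2) u)‖ ^ 2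
      = Real.sin (π * ((N : ℝ) + 1 / 2 + u)) ^ 2 + Real.sinh (π * u) ^ 2 := by
    rw [show (π : ℂ) * line ((N : ℝ) + 1 / 2) u = ((π * ((N : ℝ) + 1 / 2 + u) : ℝ) : ℂ) + ((π * u : ℝ) : ℂ) * I by
      rw [line_eq]; push_cast; ring]
    exact sq_norm_sin_ofReal_add_mul_I _ _
  have hsin : Real.sin (π * ((N : ℝ) + 1 / 2 + u)) ^ 2 = Real.cos (π * u) ^ 2 := by
    rw [show π * ((N : ℝ) + 1 / 2 + u) = (π * u + π / 2) + (N : ℕ) * π by ring,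
      Real.sin_add_nat_mul_pi, Real.sin_add_pi_div_two, mul_pow]
    have : ((-1 : ℝ) ^ N) ^ 2 = 1 := by rw [← pow_mul, mul_comm, pow_mul]; norm_num
    rw [this, one_mul]
  have h1 : 1 ≤ ‖Complex.sin (π * line ((N : ℝ) + 1 / 2) u)‖ ^ 2 := by
    rw [hsq, hsin]
    have hs := Real.sin_sq_le_sq (x := π * u)
    have hsh : (π * u) ^ 2 ≤ Real.sinh (π * u) ^ 2 := by
      have h0 : |π * u| ≤ Real.sinh |π * u| := Real.self_le_sinh_iff.2 (abs_nonneg _)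
      rw [← Real.abs_sinh] at h0
      nlinarith [abs_nonneg (π * u), sq_abs (π * u), sq_abs (Real.sinh (π * u))]
    nlinarith [Real.sin_sq_add_cos_sq (π * u)]
  have h2 : 1 ≤ ‖Complex.sin (π * line ((N : ℝ) + 1 / 2) u)‖ := by
    nlinarith [norm_nonneg (Complex.sin (π * line ((N : ℝ) + 1 / 2) u))]
  rw [norm_mul, norm_mul, Complex.norm_I, Complex.norm_ofNat, mul_one]
  linarith

/-- **Continuity of `a ↦ M_N(a)`**, the leading-term integral on the fixed line through `N + ½`, by dominated
convergence (the Gaussian majorant `½e^{−4πu(u+d)}` is locally uniform in `d = N + ½ − a`).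
[cite: AriasDeReyna2011, eq. (5.2)] -/
theorem continuous_leadIntegral (N : ℕ) : Continuous fun a : ℝ ↦ (1 + I) * ∫ u : ℝ,
    cexp (2 * π * I * (line (N + 1 / 2) u - a) ^ 2) / (2 * I * Complex.sin (π * line (N + 1 / 2) u)) := by
  refine continuous_const.mul (continuous_iff_continuousAt.2 fun a₀ ↦ ?_)
  have hden : ∀ u : ℝ, 2 * I * Complex.sin (π * line ((N : ℝ) + 1 / 2) u) ≠ 0 := fun u h ↦ by
    have := two_le_norm_den N u; rw [h, norm_zero] at this; linarith
  set D : ℝ := |(N : ℝ) + 1 / 2 - a₀| + 1 with hD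
  have hD0 : 0 ≤ D := by positivity
  refine continuousAt_of_dominated
    (bound := fun u ↦ 1 / 2 * ((1 + |u|) ^ 0 * Real.exp (-2 * π * u ^ 2 + 0 * u + 2 * π * D ^ 2))) ?_ ?_ ?_ ?_
  · refine Eventually.of_forall fun a ↦ Continuous.aestronglyMeasurable ?_
    exact (by fun_prop : Continuous fun u : ℝ ↦ cexp (2 * π * I * (line ((N : ℝ) + 1 / 2) u - a) ^ 2)).div
      (by fun_prop) hden
  · have hI : Ioo (a₀ - 1) (a₀ + 1) ∈ 𝓝 a₀ := Ioo_mem_nhds (by linarith) (by linarith)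
    filter_upwards [hI] with a ha
    refine Eventually.of_forall fun u ↦ (norm_lead_integrand_le N a u).trans ?_
    rw [pow_zero, one_mul, zero_mul, add_zero]
    refine mul_le_mul_of_nonneg_left (Real.exp_le_exp.2 ?_) (by norm_num)
    have hd : |(N : ℝ) + 1 / 2 - a| ≤ D := by
      have h1 := abs_sub_abs_le_abs_sub ((N : ℝ) + 1 / 2 - a) ((N : ℝ) + 1 / 2 - a₀)
      have h2 : |((N : ℝ) + 1 / 2 - a) - ((N : ℝ) + 1 / 2 - a₀)| < 1 := by
        rw [show ((N : ℝ) + 1 / 2 - a) - ((N : ℝ) + 1 / 2 - a₀) = a₀ - a by ring]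
        exact abs_sub_lt_iff.2 ⟨by linarith [ha.1], by linarith [ha.2]⟩
      rw [hD]; linarith
    have h1 : -(4 * π * u * ((N : ℝ) + 1 / 2 - a)) ≤ 4 * π * (|u| * D) := by
      have h3 : |u * ((N : ℝ) + 1 / 2 - a)| ≤ |u| * D := by
        rw [abs_mul]; exact mul_le_mul_of_nonneg_left hd (abs_nonneg u)
      have h4 := neg_abs_le (u * ((N : ℝ) + 1 / 2 - a))
      nlinarith [Real.pi_pos]
    nlinarith [sq_nonneg (|u| - D), sq_abs u, Real.pi_pos]
  · exact (integrable_poly_mul_gaussian 0 0 (2 * π * D ^ 2)).const_mul _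
  · refine Eventually.of_forall fun u ↦ ?_
    exact ((by fun_prop : Continuous fun a : ℝ ↦ cexp (2 * π * I * (line ((N : ℝ) + 1 / 2) u - a) ^ 2)).div_const
      _).continuousAt

/-- **`|M(N)| ≤ ½` at the integers `N ≥ 1`**, by continuity from the right (`M(a) = M_N(a)` on `[N, N+1)`).
[cite: AriasDeReyna2011, Thm. 6.1 (case `n = 0`; `F(1) = (e^{3πi/8} − (√2/2)e^{πi/8})/2`, `|F| ≤ ½` on `[−1, 1]`)] -/
theorem norm_leadM_le_half_nat {N : ℕ} (hN : 1 ≤ N) : ‖leadM N‖ ≤ 1 / 2 := by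
  set L : ℝ → ℂ := fun a : ℝ ↦ (1 + I) * ∫ u : ℝ,
    cexp (2 * π * I * (line (N + 1 / 2) u - a) ^ 2) / (2 * I * Complex.sin (π * line (N + 1 / 2) u)) with hL
  have hLM : ∀ a ∈ Ico (N : ℝ) (N + 1), leadM a = L a := fun a ha ↦ by
    simp only [hL, leadM, Nat.floor_eq_on_Ico N a ha]
  have hcont : Tendsto (fun a ↦ ‖L a‖) (𝓝[>] (N : ℝ)) (𝓝 ‖L N‖) :=
    (((continuous_leadIntegral N).tendsto (N : ℝ)).norm).mono_left nhdsWithin_le_nhds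
  have hev : ∀ᶠ a in 𝓝[>] (N : ℝ), ‖L a‖ ≤ 1 / 2 := by
    filter_upwards [Ioo_mem_nhdsGT (by linarith : (N : ℝ) < N + 1)] with a ha
    rw [← hLM a ⟨ha.1.le, ha.2⟩]
    have hN1 : (1 : ℝ) ≤ N := by exact_mod_cast hN
    refine norm_leadM_le_half (by linarith [ha.1]) fun n hn ↦ ?_
    rw [← hn] at ha
    have h1 : (N : ℤ) < n := by exact_mod_cast ha.1
    have h2 : n < (N : ℤ) + 1 := by exact_mod_cast ha.2
    omega
  have h := le_of_tendsto hcont hev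
  rwa [← hLM N ⟨le_rfl, by linarith⟩] at h

/-- **`|C₀| ≤ ½` for every `a > 0`** (Arias de Reyna 2011, Thm. 6.1 with `n = 0`: `|F(p)| ≤ ½` on `[−1, 1]`).
[cite: AriasDeReyna2011, Thm. 6.1 (case `n = 0`), eq. (5.2)] -/
theorem norm_coefC0_le_of_pos {a : ℝ} (ha : 0 < a) : ‖coefC0 a‖ ≤ 1 / 2 := by
  rw [norm_coefC0]
  by_cases hai : ∃ n : ℤ, (n : ℝ) = a
  · obtain ⟨n, rfl⟩ := hai
    have hn : (0 : ℤ) < n := by exact_mod_cast ha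
    obtain ⟨N, rfl⟩ := Int.eq_ofNat_of_zero_le hn.le
    rw [Int.cast_natCast]
    exact norm_leadM_le_half_nat (by exact_mod_cast hn)
  · exact norm_leadM_le_half ha fun n hn ↦ hai ⟨n, hn⟩

end AriasDeReyna

end Literature.NumberTheory.LFunctions
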